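import Summits.FinalStateConjecture.FinalStateConjecture.Theorems.SwallowTheDatumKerrShieldedDataExistAssemblyGlue
import Literature.Geometry.Lorentzian.KerrCylinderVacuum
import Literature.Geometry.Lorentzian.ChartSecondFundamentalFormDilation
import Literature.Geometry.Lorentzian.UnitNormalUniqueness
import Mathlib.Analysis.SpecialFunctions.Trigonometric.Arctan
import HarnessLib

/-!
# `KerrShieldedDataExist`, line `plug-the-second-sheet` (skeleton v4 "KerrCap") — stub `stub_capGlue`:
# gluing the Li–Mei pocket to the induced vacuum data of the cap map

Support file (`--supports stmt-FinalStateConjecture-10055`; everything proved, no definitions, no named facts):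
the registered stub `stub_capGlue` of `Cruxes/KerrShieldedDataExist/Lines/plug_the_second_sheet.lean`, proved
verbatim. The pocket datum `D'` on `E3` is vacuum on the ball `{‖y‖ < ρ₂}` (`LiMei.IsVacuumOn`) and is EXACTLY
the standard Kerr(`M, a`)-cylinder datum `{r = r₀}`, `r₋ < r₀ < r₊`, on the collar `{σ₂ < ‖y‖ < ρ₂}`
(`LiMei.IsKerrCylinderOn M a r₀ τ₀ id`: `h = ψ^* g`, `k = K_ν(ψ)` for the pinned frame `ψ = kerrCylMap r₀ a τ₀ id`
into a chart `Kerr.region a r₁` and its future unit normal); the cap map `Ψ(u) = (τ(s), X u)`, `s = ‖u‖`, is a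
smooth spacelike immersion of `Ω = {σ₂' < ‖u‖}` into `Kerr.region a r_c` with a smooth future unit normal `N`,
with cylinder profiles `τ = s + τ₀`, `ϱ = r₀`, `α = −arctan(a/r₀)` on `s ≤ ρ₂`.

* `KerrCap.capImm_eq_kerrCylMap` — on the cylinder zone the cap map IS `kerrCylMap r₀ a τ₀ id`, pointwise
  (`cos(−arctan(a/r₀)) = r₀/√(r₀² + a²)`, `sin(−arctan(a/r₀)) = −a/√(r₀² + a²)`; Visser arXiv:0706.0622, (32)–(35));
* `KerrCap.inducedBilin_eq_of_eventuallyEq_repr`, `KerrCap.secondFundamentalForm_eq_of_eventuallyEq_repr` — the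
  induced form and the second fundamental form of maps between chart domains, for two metrics with the SAME
  components `G` on two chart domains, only depend on the germs of the representatives of the map and of the
  normal (the coordinate formulas `G(DΦ v, DΦ w)`, `G(DN v + Γ(N)(DΦ v), DΦ w)` of
  `OpensChart.secondFundamentalForm_eq_of_repr` are literal in these data; O'Neill 1983, Ch. 4, Lemma 4.1/4.4) —
  this compares data read in the two charts `Kerr.region a r₁` (pocket) and `Kerr.region a r_c` (cap);
* `KerrCap.isFutureUnitNormal_kerrCylUnitNormalOn` — the Kerr cylinder frame on ANY open `U ⊆ {y ≠ 0}` has the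
  future unit normal `kerrCylUnitNormal` (the tree's `LiMei.isFutureUnitNormal_kerrCylUnitNormal` is `U = slice 0 1`);
* **`stub_capGlue`** — on the collar `W = {σ₂' < ‖u‖ < ρ₂}` the restriction of `Ψ` is a Kerr cylinder frame, so by
  uniqueness of the future unit normal (`IsFutureUnitNormal.apply_eq_of_eq`, O'Neill 1983, Ch. 5, p. 145)
  `N = kerrCylUnitNormal ∘ Ψ` there, as is the pocket's normal (`LiMei.eq_kerrCylUnitNormal`); hence the induced
  vacuum datum of `Ψ` on `Ω` (`exists_initialDataSet_induced_isVacuumConstraintSolution`, `Kerr.ricci_smoothMetric`)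
  and `D'` have the same sections on `W`, and the total fields "induced data on `Ω`, pocket elsewhere" glue
  (`Assembly.exists_initialDataSet_of_localData`; local models: the induced datum on `Ω`, the pocket restricted to
  the ball `{‖y‖ < ρ₂}` — vacuum by `isVacuumAt_comap_iff` — elsewhere) to ONE vacuum datum `C` on `E3` which IS
  the induced datum of `Ψ` on `Ω`. Li–Mei arXiv:2005.01249, Prop. 4.1; Bartnik–Isenberg 2004, §2.

References: J. Li, H. Mei, CMP 378 (2020) = arXiv:2005.01249, Prop. 4.1; M. Visser arXiv:0706.0622, (32)–(35);
B. O'Neill 1983, Ch. 3 Prop. 3.13, Ch. 4 Lemma 4.1/4.4, Ch. 5 p. 145; R. Bartnik, J. Isenberg (2004), §2.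
-/

-- the doubled `FinalStateConjecture` path component is the summit/problem naming scheme, not a mistake
set_option linter.dupNamespace false

noncomputable section

open Set Function Filter Topology TopologicalSpace
open scoped Manifold ContDiff Topology InnerProductSpace
open Literature.Geometry.Lorentzian

namespace Summit.FinalStateConjecture.FinalStateConjecture.Theorems.SwallowTheDatum

namespace KerrCap

/-- **On the cylinder zone the cap map IS the standard Kerr cylinder map.** If at `s = ‖u‖` the profiles
take the cylinder values `τ = s + τ₀`, `ϱ = r₀ > 0`, `α = −arctan(a/r₀)`, then
`(τ(s), X u) = kerrCylMap r₀ a τ₀ id u = (‖u‖ + τ₀, ellipsoidPt r₀ a (u/‖u‖))`: with `cos α = r₀/√(r₀² + a²)`,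
`sin α = −a/√(r₀² + a²)` one has `r₀ cos α − a sin α = √(r₀² + a²)`, `r₀ sin α + a cos α = 0`, i.e.
`L_{r₀} Rot_z(α) n = ellipsoidPt r₀ a n`. Visser arXiv:0706.0622, (32)–(35). [cite: arXiv07060622, (32)–(35)] -/
theorem capImm_eq_kerrCylMap {ϱ α τ : ℝ → ℝ} {a r₀ τ₀ : ℝ} {X : E3 → E3}
    (hX : ∀ u : E3, X u =
      !₂[(ϱ ‖u‖ * (Real.cos (α ‖u‖) * u 0 - Real.sin (α ‖u‖) * u 1) -
            a * (Real.sin (α ‖u‖) * u 0 + Real.cos (α ‖u‖) * u 1)) / ‖u‖,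
         (ϱ ‖u‖ * (Real.sin (α ‖u‖) * u 0 + Real.cos (α ‖u‖) * u 1) +
            a * (Real.cos (α ‖u‖) * u 0 - Real.sin (α ‖u‖) * u 1)) / ‖u‖,
         ϱ ‖u‖ * u 2 / ‖u‖])
    (hr₀ : 0 < r₀) {u : E3} (hτ : τ ‖u‖ = ‖u‖ + τ₀) (hϱ : ϱ ‖u‖ = r₀)
    (hα : α ‖u‖ = -Real.arctan (a / r₀)) :
    E4.ofTimeSpace (τ ‖u‖) (X u) = LiMei.kerrCylMap r₀ a τ₀ LinearIsometry.id u := by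
  set R : ℝ := Real.sqrt (r₀ ^ 2 + a ^ 2) with hR
  have hR2 : R ^ 2 = r₀ ^ 2 + a ^ 2 := Real.sq_sqrt (by positivity)
  have hRpos : 0 < R := Real.sqrt_pos.2 (by positivity)
  have hT : Real.sqrt (1 + (a / r₀) ^ 2) = R / r₀ := by
    rw [show (1 : ℝ) + (a / r₀) ^ 2 = (r₀ ^ 2 + a ^ 2) / r₀ ^ 2 by field_simp,
      Real.sqrt_div (by positivity), Real.sqrt_sq hr₀.le]
  have hcos : Real.cos (α ‖u‖) = r₀ / R := by
    rw [hα, Real.cos_neg, Real.cos_arctan, hT]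
    field_simp
  have hsin : Real.sin (α ‖u‖) = -(a / R) := by
    rw [hα, Real.sin_neg, Real.sin_arctan, hT]
    field_simp
  have key : r₀ * (r₀ / R) + a * (a / R) = R := by
    field_simp
    linear_combination -hR2
  rw [LiMei.kerrCylMap, hτ]
  congr 1
  rw [hX u]
  ext i
  simp only [LinearIsometry.coe_id, id_eq, LiMei.ellipsoidPt, PiLp.toLp_apply, PiLp.smul_apply,
    smul_eq_mul, hcos, hsin, hϱ]
  fin_cases i
  · simp only [Fin.zero_eta, Fin.isValue, Matrix.cons_val_zero]
    calc _ = (r₀ * (r₀ / R) + a * (a / R)) * u 0 / ‖u‖ := by ring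
      _ = _ := by rw [key]; ring
  · simp only [Fin.mk_one, Fin.isValue, Matrix.cons_val_one, Matrix.cons_val_zero]
    calc _ = (r₀ * (r₀ / R) + a * (a / R)) * u 1 / ‖u‖ := by ring
      _ = _ := by rw [key]; ring
  · simp; ring

section Charts

variable {E : Type*} [NormedAddCommGroup E] [NormedSpace ℝ E] [FiniteDimensional ℝ E]
  {E' : Type*} [NormedAddCommGroup E'] [NormedSpace ℝ E']
  {V V' : Opens E} {U U' : Opens E'} {n : ℕ∞ω}
  {g : PseudoRiemannianMetric 𝓘(ℝ, E) n E (TangentSpace 𝓘(ℝ, E) : V → Type _)}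
  {g' : PseudoRiemannianMetric 𝓘(ℝ, E) n E (TangentSpace 𝓘(ℝ, E) : V' → Type _)}
  {G : E → E →L[ℝ] E →L[ℝ] ℝ} {f : U → V} {f' : U' → V'} {Φ Φ' : E' → E}

omit [FiniteDimensional ℝ E] in
/-- **The induced form only depends on the germ of the representative and on the metric components**: for
metrics `g`, `g'` on chart domains `V, V' ⊆ E` with the same components `G`, and maps `f : U → V`, `f' : U' → V'`
from chart domains `U, U' ⊆ E'` whose representatives `Φ`, `Φ'` agree near `y₀` (`Φ` differentiable there),
`(f^* g)_{y₀} = (f'^* g')_{y₀}`: both are `G_{Φ y₀}(DΦ(y₀) ·, DΦ(y₀) ·)` (`OpensChart.mfderiv_apply_of_repr`).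
O'Neill 1983, Ch. 4, p. 97. [cite: ONeill1983, Ch. 4, p. 97] -/
theorem inducedBilin_eq_of_eventuallyEq_repr (hG : ∀ x : V, g.val x = G x) (hG' : ∀ x : V', g'.val x = G x)
    (hf : ∀ y : U, (f y : E) = Φ y) (hf' : ∀ y : U', (f' y : E) = Φ' y) {y₀ : E'} (hy : y₀ ∈ U)
    (hy' : y₀ ∈ U') (hΦΦ' : Φ =ᶠ[𝓝 y₀] Φ') (hΦ : DifferentiableAt ℝ Φ y₀) (v w : E') :
    g.inducedBilin 𝓘(ℝ, E') f ⟨y₀, hy⟩ v w = g'.inducedBilin 𝓘(ℝ, E') f' ⟨y₀, hy'⟩ v w := by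
  have hΦ' : DifferentiableAt ℝ Φ' y₀ := hΦ.congr_of_eventuallyEq hΦΦ'.symm
  have hpt : Φ y₀ = Φ' y₀ := hΦΦ'.eq_of_nhds
  have hfd : fderiv ℝ Φ' y₀ = fderiv ℝ Φ y₀ := hΦΦ'.symm.fderiv_eq
  have hval : (g'.val (f' ⟨y₀, hy'⟩) : E →L[ℝ] E →L[ℝ] ℝ) = g.val (f ⟨y₀, hy⟩) := by
    rw [hG, hG', hf, hf', hpt]
  rw [PseudoRiemannianMetric.inducedBilin_apply, PseudoRiemannianMetric.inducedBilin_apply,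
    OpensChart.mfderiv_apply_of_repr hf (y := ⟨y₀, hy⟩) hΦ,
    OpensChart.mfderiv_apply_of_repr hf (y := ⟨y₀, hy⟩) hΦ,
    OpensChart.mfderiv_apply_of_repr hf' (y := ⟨y₀, hy'⟩) hΦ',
    OpensChart.mfderiv_apply_of_repr hf' (y := ⟨y₀, hy'⟩) hΦ', hfd]
  exact (congrFun (congrArg DFunLike.coe (congrFun (congrArg DFunLike.coe hval) _)) _).symm

/-- **The second fundamental form only depends on the germs of the representatives and on the metric
components**: in the situation of `inducedBilin_eq_of_eventuallyEq_repr`, for fields `ν`, `ν'` along `f`, `f'`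
whose representatives `N`, `N'` agree near `y₀` (`N` differentiable there, `G` differentiable at `Φ y₀`),
`K_ν(f)_{y₀} = K_{ν'}(f')_{y₀}`: both are `G_{Φ y₀}(DN(y₀) v + Γ_{Φ y₀}(N y₀)(DΦ(y₀) v), DΦ(y₀) w)`
(`OpensChart.secondFundamentalForm_eq_of_repr`), the Christoffel map `Γ_x = ♯(½ K)` being built from `∂G` at the
point and index raising by `g_x = G x = g'_{x'}` (`OpensChart.sharp_eq_of_val_eq`). O'Neill 1983, Ch. 4,
Lemma 4.1 and 4.4; Ch. 3, Prop. 3.13. [cite: ONeill1983, Ch. 4, Lemma 4.1 and Lemma 4.4] -/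
theorem secondFundamentalForm_eq_of_eventuallyEq_repr [FiniteDimensional ℝ E'] [g.HasLeviCivita]
    [g'.HasLeviCivita] (hG : ∀ x : V, g.val x = G x) (hG' : ∀ x : V', g'.val x = G x)
    (hf : ∀ y : U, (f y : E) = Φ y) (hf' : ∀ y : U', (f' y : E) = Φ' y)
    {ν : NormalField 𝓘(ℝ, E) f} {ν' : NormalField 𝓘(ℝ, E) f'} {N N' : E' → E}
    (hν : ∀ y : U, ν y = N y) (hν' : ∀ y : U', ν' y = N' y) {y₀ : E'} (hy : y₀ ∈ U) (hy' : y₀ ∈ U')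
    (hΦΦ' : Φ =ᶠ[𝓝 y₀] Φ') (hNN' : N =ᶠ[𝓝 y₀] N') (hΦ : DifferentiableAt ℝ Φ y₀)
    (hN : DifferentiableAt ℝ N y₀) (hGd : DifferentiableAt ℝ G (Φ y₀)) (v w : E') :
    g.secondFundamentalForm 𝓘(ℝ, E') f ν ⟨y₀, hy⟩ v w =
      g'.secondFundamentalForm 𝓘(ℝ, E') f' ν' ⟨y₀, hy'⟩ v w := by
  have hΦ' : DifferentiableAt ℝ Φ' y₀ := hΦ.congr_of_eventuallyEq hΦΦ'.symm
  have hN' : DifferentiableAt ℝ N' y₀ := hN.congr_of_eventuallyEq hNN'.symm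
  have hpt : Φ y₀ = Φ' y₀ := hΦΦ'.eq_of_nhds
  have hNpt : N y₀ = N' y₀ := hNN'.eq_of_nhds
  have hfd : fderiv ℝ Φ' y₀ = fderiv ℝ Φ y₀ := hΦΦ'.symm.fderiv_eq
  have hNfd : fderiv ℝ N' y₀ = fderiv ℝ N y₀ := hNN'.symm.fderiv_eq
  have hx : ((f' ⟨y₀, hy'⟩ : V') : E) = (f ⟨y₀, hy⟩ : E) := by rw [hf, hf', hpt]
  have hGd0 : DifferentiableAt ℝ G (f ⟨y₀, hy⟩) := by rw [hf]; exact hGd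
  have hGd' : DifferentiableAt ℝ G (f' ⟨y₀, hy'⟩) := by rw [hx, hf]; exact hGd
  have hval : (g'.val (f' ⟨y₀, hy'⟩) : E →L[ℝ] E →L[ℝ] ℝ) = g.val (f ⟨y₀, hy⟩) := by
    rw [hG, hG', hx]
  rw [OpensChart.secondFundamentalForm_eq_of_repr hG hf hν (y := ⟨y₀, hy⟩) hΦ hN hGd0 v w,
    OpensChart.secondFundamentalForm_eq_of_repr hG' hf' hν' (y := ⟨y₀, hy'⟩) hΦ' hN' hGd' v w,
    hfd, hNfd, ← hNpt]
  have hΓ : (OpensChart.christoffel g' G (f' ⟨y₀, hy'⟩) (N y₀) (fderiv ℝ Φ y₀ v) : E) =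
      OpensChart.christoffel g G (f ⟨y₀, hy⟩) (N y₀) (fderiv ℝ Φ y₀ v) := by
    rw [OpensChart.christoffel_apply, OpensChart.christoffel_apply, hx]
    exact OpensChart.sharp_eq_of_val_eq hval _
  rw [hΓ]
  exact (congrFun (congrArg DFunLike.coe (congrFun (congrArg DFunLike.coe hval) _)) _).symm

end Charts

/-- **The Kerr cylinder frame on any open `U ⊆ {y ≠ 0}` has the future unit normal `kerrCylUnitNormal`**
(`0 ≤ m`, `|a| < m`, `r₋ < r₀ < r₊`, any chart radius `r₁`, shift `τ₀`, rotation `R`): a unit normal of sign `−1`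
(`LiMei.isUnitNormal_kerrCylUnitNormalOn`), hence causal, and future-directed: `g(V, ν) = c · g(V, g♯dr) = −2Hc < 0`,
`c = (−g(g♯dr, g♯dr))^{-1/2} > 0`, `H = mr/Σ > 0` (`LiMei.isFutureUnitNormal_kerrCylUnitNormal` is the case
`U = Kerr.slice 0 1`). Li–Mei arXiv:2005.01249, §4, p. 22; Wald 1984, §10.2. [cite: LiMei2020, §4] -/
theorem isFutureUnitNormal_kerrCylUnitNormalOn [Kerr.Facts] {m a r₁ r₀ τ₀ : ℝ} {R : E3 →ₗᵢ[ℝ] E3}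
    {U : Opens E3} {f : U → Kerr.region a r₁} (hm : 0 ≤ m) (ha : |a| < m) (h₁ : Kerr.rMinus m a < r₀)
    (h₂ : r₀ < Kerr.rPlus m a) (hU : ∀ y : U, (y : E3) ≠ 0)
    (hf : ∀ y, (f y : E4) = LiMei.kerrCylMap r₀ a τ₀ R (y : E3)) :
    (Kerr.smoothMetric m a r₁).IsFutureUnitNormal 𝓘(ℝ, E3) ((Kerr.timeOrientation m a r₁ hm).ofLE le_top) f
      (fun y ↦ LiMei.kerrCylUnitNormal m a (f y : E4)) := by
  have hm0 : 0 < m := Kerr.IsSubextremal.pos ha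
  have hun := LiMei.isUnitNormal_kerrCylUnitNormalOn (r₁ := r₁) ha h₁ h₂ hU hf
  refine ⟨hun, fun y ↦ ⟨?_, ?_⟩⟩
  · -- causal
    have ht : (Kerr.smoothMetric m a r₁).IsTimelike (x := f y) (LiMei.kerrCylUnitNormal m a (f y : E4)) := by
      rw [LorentzianMetric.isTimelike_iff]
      have h := hun.2 y
      exact h ▸ neg_one_lt_zero
    exact ht.isCausal
  · -- future: `g(V, ν) = −2Hc < 0`
    obtain ⟨hx, hq⟩ := LiMei.radius_pos_and_bilin_radiusSharp_neg ha h₁ h₂ hU hf y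
    rw [TimeOrientation.vectorField_ofLE, Kerr.smoothMetric_val]
    show Kerr.bilin m a (f y : E4) (Kerr.timeVector m a (f y : E4)) (LiMei.kerrCylUnitNormal m a (f y : E4)) < 0
    rw [LiMei.kerrCylUnitNormal, map_smul, smul_eq_mul, Kerr.bilin_timeVector_radiusSharp m hx]
    have hc : 0 < (√(-Kerr.bilin m a (f y : E4) (Kerr.radiusSharp m a (f y : E4))
        (Kerr.radiusSharp m a (f y : E4))))⁻¹ := inv_pos.2 (Real.sqrt_pos.2 (by linarith))
    have hH : 0 < Kerr.scalarH m a (f y : E4) := by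
      rw [Kerr.scalarH_eq_div_blSigma m a hx]
      exact div_pos (mul_pos hm0 hx) (Kerr.blSigma_spatial_pos hx)
    nlinarith

end KerrCap

/-- **Stub `stub_capGlue` of the line `plug-the-second-sheet` (v4 "KerrCap"), proved verbatim** (gluing on
`E3`): the pocket datum `D'` (vacuum on `{‖y‖ < ρ₂}`, exact standard Kerr cylinder on `{σ₂ < ‖y‖ < ρ₂}`) and the
vacuum datum induced by the cap map `Ψ` on `Ω = {‖u‖ > σ₂'}` (`InducedVacuumData.lean`, `Kerr.ricci_smoothMetric`)
agree on the collar `{σ₂' < ‖u‖ < ρ₂}` — there `Ψ = kerrCylMap r₀ a τ₀ id` pointwise (`KerrCap.capImm_eq_kerrCylMap`),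
so the induced metrics agree and, the future unit normal being unique (`IsFutureUnitNormal.apply_eq_of_eq`,
`LiMei.eq_kerrCylUnitNormal`), so do the second fundamental forms (`KerrCap.*_eq_of_eventuallyEq_repr`) — and glue
(`Assembly.exists_initialDataSet_of_localData`; local models: the induced datum on `Ω`, the pocket restricted to the
ball `{‖y‖ < ρ₂}`, vacuum by `isVacuumAt_comap_iff`) to one vacuum datum `C` on `E3` which IS the induced datum of
`Ψ` on `Ω`. [cite: LiMei2020, Prop. 4.1] [cite: BartnikIsenberg2004, §2] -/
theorem stub_capGlue :
    ∀ [Kerr.Facts] (M a r₀ τ₀ σ₂ σ₂' ρ₂ rc : ℝ) (hM : 0 ≤ M) (D' : InitialDataSet (𝓡 3) E3)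
      (τ ϱ α : ℝ → ℝ) (X : E3 → E3) (Ω : Opens E3) (Ψ : Ω → Kerr.region a rc) (N : E3 → E4),
      |a| < M → Kerr.rMinus M a < r₀ → r₀ < Kerr.rPlus M a → 0 ≤ rc → rc < r₀ →
      1 ≤ σ₂ → σ₂ < σ₂' → σ₂' < ρ₂ →
      LiMei.IsVacuumOn {y : E3 | ‖y‖ < ρ₂} D' →
      LiMei.IsKerrCylinderOn M a r₀ τ₀ LinearIsometry.id {y : E3 | σ₂ < ‖y‖ ∧ ‖y‖ < ρ₂} D' →
      (∀ s, s ≤ ρ₂ → τ s = s + τ₀ ∧ ϱ s = r₀ ∧ α s = -Real.arctan (a / r₀)) →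
      (∀ u : E3, X u =
        !₂[(ϱ ‖u‖ * (Real.cos (α ‖u‖) * u 0 - Real.sin (α ‖u‖) * u 1) -
              a * (Real.sin (α ‖u‖) * u 0 + Real.cos (α ‖u‖) * u 1)) / ‖u‖,
           (ϱ ‖u‖ * (Real.sin (α ‖u‖) * u 0 + Real.cos (α ‖u‖) * u 1) +
              a * (Real.cos (α ‖u‖) * u 0 - Real.sin (α ‖u‖) * u 1)) / ‖u‖,
           ϱ ‖u‖ * u 2 / ‖u‖]) →
      (Ω : Set E3) = {u : E3 | σ₂' < ‖u‖} →
      (∀ u : Ω, (Ψ u : E4) = E4.ofTimeSpace (τ ‖(u : E3)‖) (X u)) →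
      (Kerr.smoothMetric M a rc).IsSpacelikeImmersion 𝓘(ℝ, E3) Ψ → ContDiffOn ℝ ∞ N Ω →
      (Kerr.smoothMetric M a rc).IsFutureUnitNormal 𝓘(ℝ, E3)
        ((Kerr.timeOrientation M a rc hM).ofLE le_top) Ψ (fun u ↦ N u) →
      ∃ C : InitialDataSet (𝓡 3) E3,
        (∀ [C.metric.HasLeviCivita], C.IsVacuumConstraintSolution) ∧
        (∀ (u : Ω) (v w : E3), C.h.inner (u : E3) v w =
          (Kerr.smoothMetric M a rc).inducedBilin 𝓘(ℝ, E3) Ψ u v w) ∧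
        (∀ [(Kerr.smoothMetric M a rc).HasLeviCivita] (u : Ω) (v w : E3), C.k (u : E3) v w =
          (Kerr.smoothMetric M a rc).secondFundamentalForm 𝓘(ℝ, E3) Ψ (fun u ↦ N u) u v w) := by
  intro inst M a r₀ τ₀ σ₂ σ₂' ρ₂ rc hM D' τ ϱ α X Ω Ψ N ha hr₀m hr₀p _hrc0 _hrc hσ₂ hσ₂' hρ₂ hvac hcyl
    hzone hX hΩ hΨ hsp hNs hN
  classical
  have hr₀ : 0 < r₀ := (Kerr.IsSubextremal.rMinus_nonneg ha).trans_lt hr₀m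
  have hmemΩ : ∀ {u : E3}, u ∈ Ω ↔ σ₂' < ‖u‖ := fun {u} ↦ by rw [← SetLike.mem_coe, hΩ]; rfl
  have hne : ∀ {u : E3}, σ₂' < ‖u‖ → u ≠ 0 := fun hu h0 ↦ by
    rw [h0, norm_zero] at hu; linarith
  set Φ : E3 → E4 := fun u ↦ E4.ofTimeSpace (τ ‖u‖) (X u) with hΦdef
  have hΨΦ : ∀ u : Ω, (Ψ u : E4) = Φ u := hΨ
  have hΦd : ∀ u : Ω, DifferentiableAt ℝ Φ (u : E3) := fun u ↦
    OpensChart.differentiableAt_of_repr hΨΦ ((hsp.1 u).mdifferentiableAt (by simp))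
  -- on `{‖u‖ ≤ ρ₂}` the cap map IS the standard Kerr cylinder map
  have hcylId : ∀ {u : E3}, ‖u‖ ≤ ρ₂ → Φ u = LiMei.kerrCylMap r₀ a τ₀ LinearIsometry.id u :=
    fun {u} hu ↦ KerrCap.capImm_eq_kerrCylMap hX hr₀ (hzone _ hu).1 (hzone _ hu).2.1 (hzone _ hu).2.2
  -- the induced vacuum datum of `Ψ` on `Ω`
  haveI hLC : (Kerr.smoothMetric M a rc).HasLeviCivita :=
    (Kerr.smoothMetric M a rc).toPseudoRiemannianMetric.hasLeviCivita
  have hlift := OpensChart.contMDiff_lift_of_contDiffOn hsp.contMDiff_self (ν := fun u ↦ N u) (N := N)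
    (fun _ ↦ rfl) hNs
  obtain ⟨DΩ, hDΩh, hDΩk, hDΩvac⟩ :=
    (Kerr.smoothMetric M a rc).toPseudoRiemannianMetric.exists_initialDataSet_induced_isVacuumConstraintSolution
      hsp hN.1 hlift (m := 3) finrank_euclideanSpace_fin finrank_euclideanSpace_fin
      (fun u ↦ Kerr.ricci_smoothMetric M a rc (Ψ u))
  -- the Kerr cylinder frame of the pocket and its explicit future unit normal
  obtain ⟨r₁, hm', ψ, ν', -, hψ, -, hν', hh, hk⟩ := hcyl
  haveI hLC' : (Kerr.smoothMetric M a r₁).HasLeviCivita :=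
    (Kerr.smoothMetric M a r₁).toPseudoRiemannianMetric.hasLeviCivita
  have hνrep : ∀ z : Kerr.slice 0 1,
      ν' z = LiMei.kerrCylUnitNormal M a (LiMei.kerrCylMap r₀ a τ₀ LinearIsometry.id z) := fun z ↦ by
    rw [LiMei.eq_kerrCylUnitNormal hm' ha hr₀m hr₀p τ₀ LinearIsometry.id hψ hν' z, hψ z]
  -- the collar `W = {σ₂' < ‖u‖ < ρ₂}`
  set Wc : Opens E3 := ⟨{u : E3 | σ₂' < ‖u‖ ∧ ‖u‖ < ρ₂},
    (isOpen_lt continuous_const continuous_norm).inter (isOpen_lt continuous_norm continuous_const)⟩ with hWc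
  have hWmem : ∀ {z : E3}, z ∈ Wc ↔ σ₂' < ‖z‖ ∧ ‖z‖ < ρ₂ := Iff.rfl
  have hWΩ : ∀ {z : E3}, z ∈ Wc → z ∈ Ω := fun hz ↦ hmemΩ.2 (hWmem.1 hz).1
  have hW1 : ∀ {z : E3}, z ∈ Wc → z ∈ Kerr.slice 0 1 := fun hz ↦ by
    rw [Kerr.mem_slice_zero_iff, max_eq_left zero_le_one]
    linarith [(hWmem.1 hz).1]
  have hWs : ∀ {z : E3}, z ∈ Wc → z ∈ {y : E3 | σ₂ < ‖y‖ ∧ ‖y‖ < ρ₂} := fun hz ↦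
    ⟨by linarith [(hWmem.1 hz).1], (hWmem.1 hz).2⟩
  have hW0 : ∀ z : Wc, (z : E3) ≠ 0 := fun z ↦ hne (hWmem.1 z.2).1
  -- `Ψ` restricted to the collar is a Kerr cylinder frame …
  set ΨW : Wc → Kerr.region a rc := fun z ↦ Ψ ⟨z, hWΩ z.2⟩ with hΨW
  have hΨWΦ : ∀ z : Wc, (ΨW z : E4) = Φ z := fun z ↦ hΨΦ _
  have hΨWrep : ∀ z : Wc, (ΨW z : E4) = LiMei.kerrCylMap r₀ a τ₀ LinearIsometry.id (z : E3) :=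
    fun z ↦ by rw [hΨWΦ, hcylId (hWmem.1 z.2).2.le]
  -- … with the two future unit normals `kerrCylUnitNormal ∘ ΨW` and `N`, which therefore agree
  have hfun₁ := KerrCap.isFutureUnitNormal_kerrCylUnitNormalOn hM ha hr₀m hr₀p hW0 hΨWrep
  have hfun₂ : (Kerr.smoothMetric M a rc).IsFutureUnitNormal 𝓘(ℝ, E3)
      ((Kerr.timeOrientation M a rc hM).ofLE le_top) ΨW (fun z ↦ N z) := by
    refine ⟨⟨fun z v ↦ ?_, fun z ↦ hN.1.2 ⟨z, hWΩ z.2⟩⟩, fun z ↦ hN.2 ⟨z, hWΩ z.2⟩⟩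
    have h := hN.1.1 ⟨z, hWΩ z.2⟩ v
    rw [OpensChart.mfderiv_apply_of_repr hΨΦ (hΦd _)] at h
    rw [OpensChart.mfderiv_apply_of_repr hΨWΦ (hΦd ⟨z, hWΩ z.2⟩)]
    exact h
  have hNW : ∀ z : Wc, N z = LiMei.kerrCylUnitNormal M a (LiMei.kerrCylMap r₀ a τ₀ LinearIsometry.id z) :=
    fun z ↦ hfun₁.apply_eq_of_eq (by rw [finrank_euclideanSpace_fin, finrank_euclideanSpace_fin])
      (LiMei.isSpacelikeImmersion_kerrCylOn ha hr₀m hr₀p hW0 hΨWrep) hfun₂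
      (N₁ := fun z : Wc ↦ LiMei.kerrCylUnitNormal M a (LiMei.kerrCylMap r₀ a τ₀ LinearIsometry.id z))
      (N₂ := fun z : Wc ↦ N z) (fun z ↦ by simp only [hΨWrep z]) (fun _ ↦ rfl) z
  -- hence the induced data of `Ψ` and the pocket datum agree on the collar
  have hagree : ∀ (z : E3) (hz : z ∈ Wc) (v w : E3),
      DΩ.h.inner ⟨z, hWΩ hz⟩ v w = D'.h.inner z v w ∧ DΩ.k ⟨z, hWΩ hz⟩ v w = D'.k z v w := by
    intro z hz v w
    have hO : IsOpen {y : E3 | ‖y‖ < ρ₂} := isOpen_lt continuous_norm continuous_const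
    have hΦev : Φ =ᶠ[𝓝 z] LiMei.kerrCylMap r₀ a τ₀ LinearIsometry.id := by
      filter_upwards [hO.mem_nhds (hWmem.1 hz).2] with y hy
      exact hcylId (le_of_lt hy)
    have hNev : N =ᶠ[𝓝 z] fun y ↦
        LiMei.kerrCylUnitNormal M a (LiMei.kerrCylMap r₀ a τ₀ LinearIsometry.id y) := by
      filter_upwards [Wc.isOpen.mem_nhds hz] with y hy
      exact hNW ⟨y, hy⟩
    have hNd : DifferentiableAt ℝ N z :=
      (hNs.contDiffAt (Ω.isOpen.mem_nhds (hWΩ hz))).differentiableAt (by simp)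
    have hGd : DifferentiableAt ℝ (Kerr.bilin M a) (Φ z) := by
      rw [← hΨΦ ⟨z, hWΩ hz⟩]; exact Kerr.differentiableAt_bilin M a _
    constructor
    · rw [hDΩh]
      have e := congrArg (fun B : E3 →L[ℝ] E3 →L[ℝ] ℝ ↦ B v w) (hh ⟨z, hW1 hz⟩ (hWs hz))
      refine Eq.trans ?_ e.symm
      exact KerrCap.inducedBilin_eq_of_eventuallyEq_repr
        (g := (Kerr.smoothMetric M a rc).toPseudoRiemannianMetric)
        (g' := (Kerr.smoothMetric M a r₁).toPseudoRiemannianMetric) (G := Kerr.bilin M a)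
        (Kerr.smoothMetric_val M a rc) (Kerr.smoothMetric_val M a r₁) hΨΦ hψ (hWΩ hz) (hW1 hz) hΦev
        (hΦd ⟨z, hWΩ hz⟩) v w
    · have e1 : DΩ.k ⟨z, hWΩ hz⟩ v w = (Kerr.smoothMetric M a rc).secondFundamentalForm 𝓘(ℝ, E3) Ψ
          (fun u ↦ N u) ⟨z, hWΩ hz⟩ v w := by
        have := LinearMap.congr_fun₂ (hDΩk ⟨z, hWΩ hz⟩) v w
        exact this
      have e2 : D'.k z v w = (Kerr.smoothMetric M a r₁).secondFundamentalForm 𝓘(ℝ, E3) ψ ν'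
          ⟨z, hW1 hz⟩ v w := by
        have := LinearMap.congr_fun₂ (hk ⟨z, hW1 hz⟩ (hWs hz)) v w
        exact this
      rw [e1, e2]
      exact KerrCap.secondFundamentalForm_eq_of_eventuallyEq_repr
        (g := (Kerr.smoothMetric M a rc).toPseudoRiemannianMetric)
        (g' := (Kerr.smoothMetric M a r₁).toPseudoRiemannianMetric) (G := Kerr.bilin M a)
        (Kerr.smoothMetric_val M a rc) (Kerr.smoothMetric_val M a r₁) hΨΦ hψ (ν := fun u ↦ N u)
        (ν' := ν') (N := N) (fun _ ↦ rfl) hνrep (hWΩ hz) (hW1 hz) hΦev hNev (hΦd ⟨z, hWΩ hz⟩) hNd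
        hGd v w
  -- the total fields: the induced data on `Ω`, the pocket elsewhere
  set hF : E3 → E3 →L[ℝ] E3 →L[ℝ] ℝ := fun y ↦
    if hy : y ∈ Ω then DΩ.h.inner ⟨y, hy⟩ else D'.h.inner y with hFdef
  set kF : E3 → E3 →L[ℝ] E3 →L[ℝ] ℝ := fun y ↦
    if hy : y ∈ Ω then DΩ.k ⟨y, hy⟩ else D'.k y with kFdef
  -- local vacuum models: `DΩ` on `Ω`, the pocket restricted to the ball `{‖y‖ < ρ₂}` elsewhere
  have hloc : ∀ y : E3, ∃ (U : Opens E3) (DU : InitialDataSet 𝓘(ℝ, E3) U) (W : Set E3),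
      IsOpen W ∧ y ∈ W ∧ W ⊆ U ∧ (∀ [DU.metric.HasLeviCivita], DU.IsVacuumConstraintSolution) ∧
      ∀ z (hz : z ∈ U), z ∈ W →
        (∀ v w, hF z v w = DU.h.inner ⟨z, hz⟩ v w) ∧ (∀ v w, kF z v w = DU.k ⟨z, hz⟩ v w) := by
    intro y
    by_cases hy : y ∈ Ω
    · refine ⟨Ω, DΩ, (Ω : Set E3), Ω.isOpen, hy, subset_rfl, hDΩvac, fun z hz _ ↦ ⟨fun v w ↦ ?_, fun v w ↦ ?_⟩⟩
      · simp only [hFdef, dif_pos hz]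
        rfl
      · simp only [kFdef, dif_pos hz]
        rfl
    · have hyρ : ‖y‖ < ρ₂ := by
        have : ¬ σ₂' < ‖y‖ := fun h ↦ hy (hmemΩ.2 h)
        linarith [not_lt.1 this]
      set B : Opens E3 := ⟨{z : E3 | ‖z‖ < ρ₂}, isOpen_lt continuous_norm continuous_const⟩ with hB
      have hval : ∀ (z : B) (v : E3), mfderiv (𝓡 3) (𝓡 3) (Subtype.val : B → E3) z v = v := fun z v ↦ by
        rw [Literature.Geometry.Manifold.OpenSubmanifold.mfderiv_subtype_val]; rfl
      refine ⟨B, D'.comap (Subtype.val : B → E3) (InitialDataSet.contMDiff_subtypeVal_succ B)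
        (InitialDataSet.injective_mfderiv_subtypeVal B), (B : Set E3), B.isOpen, hyρ, subset_rfl, ?_,
        fun z hz _ ↦ ⟨fun v w ↦ ?_, fun v w ↦ ?_⟩⟩
      · intro hLCB u
        haveI : D'.metric.HasLeviCivita := PseudoRiemannianMetric.hasLeviCivita _
        unfold LiMei.IsVacuumOn at hvac
        exact (InitialDataSet.isVacuumAt_comap_iff D' (InitialDataSet.contMDiff_subtypeVal_succ B)
          (InitialDataSet.injective_mfderiv_subtypeVal B) u).2 (hvac u u.2)
      · rw [InitialDataSet.comap_h_inner, hval, hval]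
        show hF z v w = D'.h.inner z v w
        by_cases hzΩ : z ∈ Ω
        · simp only [hFdef, dif_pos hzΩ]
          exact (hagree z (hWmem.2 ⟨hmemΩ.1 hzΩ, hz⟩) v w).1
        · simp only [hFdef, dif_neg hzΩ]
          rfl
      · rw [InitialDataSet.comap_k, hval, hval]
        show kF z v w = D'.k z v w
        by_cases hzΩ : z ∈ Ω
        · simp only [kFdef, dif_pos hzΩ]
          exact (hagree z (hWmem.2 ⟨hmemΩ.1 hzΩ, hz⟩) v w).2
        · simp only [kFdef, dif_neg hzΩ]
          rfl
  obtain ⟨C, hCh, hCk, hCvac⟩ := Assembly.exists_initialDataSet_of_localData hloc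
  refine ⟨C, hCvac, fun u v w ↦ ?_, ?_⟩
  · rw [hCh]
    simp only [hFdef, SetLike.coe_mem, ↓reduceDIte, hDΩh]
    rfl
  · intro _ u v w
    rw [hCk]
    simp only [kFdef, SetLike.coe_mem, ↓reduceDIte]
    exact LinearMap.congr_fun₂ (hDΩk u) v w

end Summit.FinalStateConjecture.FinalStateConjecture.Theorems.SwallowTheDatum

end
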